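import Literature.NumberTheory.EllipticCurves.FineSelmerDevissageEquivariantProofs
import Literature.NumberTheory.EllipticCurves.FineSelmerTorsionPointFieldMuRoad
import Literature.NumberTheory.EllipticCurves.FineSelmerCongruentCurvesNumberFieldProofs
import Literature.NumberTheory.EllipticCurves.DivisionFieldReducibleBorelIndex
import Literature.NumberTheory.EllipticCurves.GoodReductionUnramifiedProofs
import Literature.NumberTheory.GaloisRepresentations.GlobalArtinMapOfCharactersProofs
import HarnessLib

/-!
# Coates–Sujatha's Conjecture A on a REDUCIBLE row from the classical `μ`-invariants of the TWO CYCLIC FIELDS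
# cut out by the characters `χ₁` (on the stable line `C`) and `χ₂` (on `E[p]/C`) — the ISOTYPIC `μ`-road
# for `E[p]` reducible (proved; no definition, no named fact, no `sorry`)

`Proofs`-style file (theorems only) in topic `NumberTheory/EllipticCurves` (namespaces
`Literature.NumberTheory.EllipticCurves.FineSelmerReducibleIsotypic` for §1–§2 and `…CoatesSujatha2005` for §3),
written by the prover seat `bsd-potss-rkm` g38 (cell `bsd-potss`; item stmt-BirchSwinnertonDyer-19196
`ReducibleKatoMember`, `--supports`; closes nothing; neither Conjecture A nor BSD is proved for any particular curve here).

THE THEOREM (`CoatesSujatha2005.conjA_of_reducible_of_classicalMuVanishes_characterFields`).  `K` a number field,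
`E = W/K` elliptic, `p` an odd prime, `C ≤ E[p]` a `Γ_K`-stable LINE (`C ≠ 0, E[p]`; so `E[p]^{ss} = χ₁ ⊕ χ₂` with `χ₁`
the character of `C` and `χ₂` that of `E[p]/C`).  Let
  `K₁ = K̄^{ker χ₁}` — `ker χ₁ = fixingSubgroup Γ_K C` (the elements fixing `C` pointwise), i.e. `K₁ = K(C) = K(P)` for a
  generator `P` of `C` (the field of definition of the kernel point of the `p`-isogeny `E → E/C`), and
  `K₂ = K̄^{ker χ₂}` — `ker χ₂ = fixingSubgroup Γ_K {y + C}` (the elements fixing every coset of `C`, i.e. acting trivially on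
  `E[p]/C`), i.e. `K₂ = K(P′)` for a generator `P′` of the kernel `E[p]/C ↪ E′[p]` of the dual isogeny `E′ = E/C → E`.
Both are cyclic over `K` of degree dividing `p − 1`.  IF the classical Iwasawa `μ`-invariant vanishes (growth form
`IwasawaTheory.ClassicalMuVanishes`) for the cyclotomic `ℤ_p`-extensions of `K₁` AND of `K₂`, THEN statement (A) holds for
`E` at `p`: the Pontryagin dual of `Sel₀(E/K_∞)[p^∞]` is finitely generated over `ℤ_p` (tree spelling `∃ γ D, Module.Finite ℤ_[p] D.X`).
Bounded-rank form: `fineSelmerDual_moduleFinite_of_reducible_of_classGroupPRank_le` (`rank_p Cl((K_i)_m) ≤ B_i` for all `m`).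

COMPARISON.  Coates–Sujatha Cor. 3.6 / Wuthrich L. 14 / the cell's g33–g37 chain ask `μ = 0` for the cyclotomic tower of the
whole BOREL FIELD `K(χ₁, χ₂)` (g37: equivalently of all its imaginary cyclic subfields, by odd-character reflection); here only
the two cyclic fields `K(χ₁)`, `K(χ₂)` enter — the `χ₁`- and `χ₂`-ISOTYPIC components of the unramified Iwasawa module of
`K(χ₁,χ₂)_∞`, which descend to `K(χ_i)_∞` by the prime-to-`p` norm (`[K(χ₁,χ₂) : K(χ_i)] ∣ p − 1`).  Over `ℚ` exactly one of
`ℚ(χ₁)`, `ℚ(χ₂)` is imaginary (`χ₁χ₂ = ω` is odd); e.g. for a rational `5`-isogeny with `χ₁ = ψ` an odd quadratic character the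
inputs are `μ₅(ℚ(√d)) = 0` and `μ₅` of the REAL cyclic quartic field `ℚ(ωψ)`.  It is the reducible twin of the cell's
torsion-point-field road `conjA_of_classicalMuVanishes_stabilizerField` (irreducible tame `E[p]`, seat conjA-anchor g19).

PROOF.  (A) ⟺ `Sel₀(K_∞, E[p])` finite (Lim–Sujatha).  EQUIVARIANT dévissage
(`FineSelmerDevissage.finite_fineSelmerInfty_of_extension_equivariant`, this seat) along `0 → C → E[p] → E[p]/C` over
`U = Gal(K̄/K(χ₁,χ₂)·K_∞)`: it suffices that the `Gal(K̄/K_∞)`-EQUIVARIANT everywhere-unramified homomorphisms `U → E[p]/C` and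
`U → C` be finite.  By the cell's equivariant class-field-theoretic count
(`EquivariantUnramifiedHomsZpTowerFinite.equivariantUnramifiedHoms_finite_of_card_le`, conjA-anchor g19) this follows from a
uniform bound on the `Gal(K̄/K_n)`-equivariant additive maps `Cl(K(χ₁,χ₂)·K_n) → V` (`V = C` resp. `E[p]/C`); §2's descent
(`ν(i(N c)) = #S · ν(c)` for `S` = the image of `ker χ_i ∩ Gal(K̄/K_n)`, of order prime to `p`, acting TRIVIALLY on the
one-dimensional `V`) bounds those by `#Hom(Cl(K(χ_i)·K_n), V) ≤ p^{[Cl : Cl^p]}`, and `K(χ_i)·K_n` is a layer of the (shifted)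
cyclotomic `ℤ_p`-extension of `K(χ_i)` (tree `ZpExtension.exists_zpExtension_shift`), whose `[Cl : Cl^p] = p^{rank_p}` is bounded.

References: [CoatesSujatha2005] J. Coates, R. Sujatha, Math. Ann. 331 (2005), §3 Thm. 3.4, Lemma 3.8, Cor. 3.6; [Wuthrich2014]
Lemma 14; [Lim2017FineSelmer] §3 (isotypic reading); [DeoRaySujatha2023] §3 Thm. 3.8/3.9, §5 Lemma 5.1 (descent to `ℚ(P)`);
[Washington1997] §10.2, §13.1, §13.3 Prop. 13.23; [NeukirchANT1999] Ch. III §1 Prop. (1.6) (iv), Ch. IV §1; [SilvermanAEC2009]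
III.§8, VII.4.1; [LimSujatha2018] §3.
-/

set_option autoImplicit false

noncomputable section

open scoped Classical Pointwise NumberField
open NumberField IsDedekindDomain Field IntermediateField

/-! ## §1 The kernels of `χ₁` and `χ₂` as subgroups of `Γ_K`; restriction counts -/

namespace Literature.NumberTheory.EllipticCurves.FineSelmerReducibleIsotypic

open Literature.NumberTheory.GaloisRepresentations Literature.NumberTheory.NumberFields
  Literature.NumberTheory.EllipticCurves Literature.NumberTheory.EllipticCurves.ZpExtension
  Literature.NumberTheory.IwasawaTheory Literature.NumberTheory.IwasawaTheory.EquivariantUnramifiedHomsZpTowerFinite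
  Literature.NumberTheory.EllipticCurves.CoatesSujatha2005
-- `_root_`: some import closures declare `Literature.NumberTheory.EllipticCurves.WeierstrassCurve.*`
open _root_.WeierstrassCurve

variable {K : Type} [Field K]

section Kernels

variable {W : WeierstrassCurve K} {p : ℕ} {C : AddSubgroup (W.geomTorsion (p : ℤ))}

/-- `σ • (y + C) = σ•y + C` for a `Γ_K`-stable subgroup `C ≤ E[p]` (stability for `σ` and `σ⁻¹`). [folklore] -/
private theorem smul_vadd_coe_eq (hC : ∀ (σ : absoluteGaloisGroup K) (x : W.geomTorsion (p : ℤ)), x ∈ C → σ • x ∈ C)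
    (σ : absoluteGaloisGroup K) (y : W.geomTorsion (p : ℤ)) :
    σ • (y +ᵥ (C : Set (W.geomTorsion (p : ℤ)))) = (σ • y) +ᵥ (C : Set (W.geomTorsion (p : ℤ))) := by
  ext z
  constructor
  · rintro ⟨w, ⟨c, hc, rfl⟩, rfl⟩
    refine ⟨σ • c, hC σ c hc, ?_⟩
    show σ • y + σ • c = σ • (y + c)
    rw [smul_add]
  · rintro ⟨c, hc, rfl⟩
    refine ⟨y + σ⁻¹ • c, ⟨σ⁻¹ • c, hC σ⁻¹ c hc, rfl⟩, ?_⟩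
    show σ • (y + σ⁻¹ • c) = σ • y + c
    rw [smul_add, smul_inv_smul]

/-- **`ker χ₂`**: `σ` fixes every coset `y + C` (under the pointwise action) iff `σ•y − y ∈ C` for all `y ∈ E[p]`, i.e. iff `σ`
acts trivially on `E[p]/C`. [cite: Wuthrich2014, Lemma 14 (p. 396), proof (the character `χ₂` of `E[p]/C`)] -/
theorem mem_fixingSubgroup_cosets_iff
    (hC : ∀ (σ : absoluteGaloisGroup K) (x : W.geomTorsion (p : ℤ)), x ∈ C → σ • x ∈ C) (σ : absoluteGaloisGroup K) :
    σ ∈ fixingSubgroup (absoluteGaloisGroup K)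
        (Set.range fun y : W.geomTorsion (p : ℤ) => y +ᵥ (C : Set (W.geomTorsion (p : ℤ)))) ↔
      ∀ y : W.geomTorsion (p : ℤ), σ • y - y ∈ C := by
  rw [mem_fixingSubgroup_iff]
  constructor
  · intro h y
    have h1 := h _ ⟨y, rfl⟩
    rw [smul_vadd_coe_eq hC, leftAddCoset_eq_iff] at h1
    rw [sub_eq_add_neg, add_comm]
    exact C.neg_mem_iff.mp (by simpa [neg_add, neg_neg] using h1)
  · rintro h _ ⟨y, rfl⟩
    rw [smul_vadd_coe_eq hC, leftAddCoset_eq_iff]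
    have h1 := C.neg_mem (h y)
    rwa [neg_sub, sub_eq_neg_add] at h1

/-- **`ker χ₁`**: `σ ∈ fixingSubgroup Γ_K C` iff `σ` fixes `C` pointwise (Mathlib). [cite: Wuthrich2014, Lemma 14 (p. 396), proof (the character `χ₁` of `C`)] -/
theorem mem_fixingSubgroup_coe_iff (σ : absoluteGaloisGroup K) :
    σ ∈ fixingSubgroup (absoluteGaloisGroup K) (C : Set (W.geomTorsion (p : ℤ))) ↔
      ∀ x : W.geomTorsion (p : ℤ), x ∈ C → σ • x = x := by
  rw [mem_fixingSubgroup_iff]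
  exact ⟨fun h x hx => h x hx, fun h x hx => h x hx⟩

/-- `borelKernel C = ker χ₁ ∩ ker χ₂ ≤ ker χ₁`. [cite: Wuthrich2014, Lemma 14 (p. 396), proof] -/
theorem borelKernel_le_fixingSubgroup_coe :
    W.borelKernel C ≤ fixingSubgroup (absoluteGaloisGroup K) (C : Set (W.geomTorsion (p : ℤ))) := fun σ hσ =>
  (mem_fixingSubgroup_coe_iff σ).mpr (mem_borelKernel_iff.mp hσ).1

/-- `borelKernel C ≤ ker χ₂`. [cite: Wuthrich2014, Lemma 14 (p. 396), proof] -/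
theorem borelKernel_le_fixingSubgroup_cosets
    (hC : ∀ (σ : absoluteGaloisGroup K) (x : W.geomTorsion (p : ℤ)), x ∈ C → σ • x ∈ C) :
    W.borelKernel C ≤ fixingSubgroup (absoluteGaloisGroup K)
      (Set.range fun y : W.geomTorsion (p : ℤ) => y +ᵥ (C : Set (W.geomTorsion (p : ℤ)))) := fun σ hσ =>
  (mem_fixingSubgroup_cosets_iff hC σ).mpr (mem_borelKernel_iff.mp hσ).2

end Kernels

section Count

/-- `p ∤ (p − 1)²`. [folklore] -/
private theorem not_dvd_sub_one_sq {p : ℕ} (hp : p.Prime) : ¬ p ∣ (p - 1) ^ 2 := by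
  intro h
  have h1 : p ∣ p - 1 := (Nat.Prime.dvd_mul hp).mp (by simpa [sq] using h) |>.elim id id
  have h2 := Nat.le_of_dvd (Nat.sub_pos_of_lt hp.one_lt) h1
  have h3 := hp.one_lt
  omega

/-- **`#res_L(S) ∣ #Gal(L′/K)`** for `S ≤ Γ₀ ≤ Γ_K`, `L, L′ ⊆ K̄` normal over `K` with `Gal(K̄/L) = N ∩ Γ₀` and `Gal(K̄/L′) = N`: the two
restrictions of `S` have the same kernel `S ∩ N`, so `res_L(S) ≅ res_{L′}(S) ≤ Gal(L′/K)` (Lagrange).  (Abstract form of the tree's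
`natCard_map_absRestrictNormalHom_dvd_card_aut_divisionField`.) [cite: NeukirchANT1999, Ch. IV §1 (restriction to a normal subextension)] -/
theorem natCard_map_absRestrictNormalHom_dvd_card_aut (L L' : IntermediateField K (AlgebraicClosure K)) [Normal K L] [Normal K L']
    (Γ₀ S N : Subgroup (absoluteGaloisGroup K)) (hS : S ≤ Γ₀)
    (hL : ∀ σ : absoluteGaloisGroup K, absRestrictNormalHom L σ = 1 ↔ σ ∈ N ⊓ Γ₀)
    (hL' : ∀ σ : absoluteGaloisGroup K, absRestrictNormalHom L' σ = 1 ↔ σ ∈ N) :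
    Nat.card ↥(S.map (absRestrictNormalHom L)) ∣ Nat.card (L' ≃ₐ[K] L') := by
  set r₁ : ↥S →* (L ≃ₐ[K] L) := (absRestrictNormalHom L).comp S.subtype with hr₁
  set r₂ : ↥S →* (L' ≃ₐ[K] L') := (absRestrictNormalHom L').comp S.subtype with hr₂
  have hrange : S.map (absRestrictNormalHom L) = r₁.range := by
    rw [hr₁, ← MonoidHom.map_range, Subgroup.range_subtype]
  have hker : r₁.ker = r₂.ker := by
    ext σ
    rw [MonoidHom.mem_ker, MonoidHom.mem_ker]
    change absRestrictNormalHom L (σ : absoluteGaloisGroup K) = 1 ↔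
      absRestrictNormalHom L' (σ : absoluteGaloisGroup K) = 1
    rw [hL, hL', Subgroup.mem_inf]
    exact ⟨fun h => h.1, fun h => ⟨h, hS σ.2⟩⟩
  calc Nat.card ↥(S.map (absRestrictNormalHom L)) = Nat.card ↥r₁.range := by rw [hrange]
    _ = Nat.card (↥S ⧸ r₁.ker) := Nat.card_congr (QuotientGroup.quotientKerEquivRange r₁).symm.toEquiv
    _ = Nat.card (↥S ⧸ r₂.ker) := by rw [hker]
    _ = Nat.card ↥r₂.range := Nat.card_congr (QuotientGroup.quotientKerEquivRange r₂).toEquiv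
    _ ∣ Nat.card (L' ≃ₐ[K] L') := Subgroup.card_subgroup_dvd_card r₂.range

variable [NumberField K]

/-- **An equivariant additive map `Cl(𝓞_L) → V` vanishing on the classes extended from `L^S` is zero, when the lifts of `S` act
TRIVIALLY on `V` and `p ∤ #S`.**  Setting: `L ⊆ K̄` finite Galois over the number field `K`; `Γ₀, G₀ ≤ Γ_K` with `G₀` acting trivially on
the `p`-torsion `Γ_K`-module `V`; `S = res_L(G₀ ∩ Γ₀)` of order prime to `p`.  If `ν : Cl(𝓞_L) → V` is additive and `Γ₀`-equivariant and
`ν ∘ i_{L/L^S} = 0`, then `ν = 0`: `ν(i(N c)) = ∑_{s ∈ S} s̃ • ν(c) = #S • ν(c)` (Neukirch III (1.6)(iv) on classes, tree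
`classGroupExtend_classGroupNorm_fixedField_eq_prod`), and `#S • v = 0 = p • v` forces `v = 0`.  (The one-dimensional twin of the tree's
`FineSelmerStabilizerDescent.equivariantHom_eq_zero_of_comp_classGroupExtend_fixedField_eq_zero`, which needs irreducibility instead.)
[cite: NeukirchANT1999, Ch. III §1 Prop. (1.6) (iv)] [cite: DeoRaySujatha2023, §5 Lemma 5.1 (descent of Hom_G(Cl(L), ·) to a subfield)] -/
theorem equivariantHom_eq_zero_of_comp_classGroupExtend_eq_zero_of_trivial
    (L : IntermediateField K (AlgebraicClosure K)) [FiniteDimensional K L] [IsGalois K L] [NumberField L]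
    (Γ₀ G₀ : Subgroup (absoluteGaloisGroup K))
    {V : Type*} [AddCommGroup V] [DistribMulAction (absoluteGaloisGroup K) V]
    {p : ℕ} [Fact p.Prime] (hpV : ∀ v : V, p • v = 0) (hG₀ : ∀ σ ∈ G₀, ∀ v : V, σ • v = v)
    (hH : ¬ p ∣ Nat.card ↥((G₀ ⊓ Γ₀).map (absRestrictNormalHom L)))
    (ν : Additive (ClassGroup (𝓞 L)) →+ V)
    (hν : ∀ γ ∈ Γ₀, ∀ c : ClassGroup (𝓞 L),
      ν (Additive.ofMul (ClassGroup.mulEquiv (AmbiguousClass.intAut (absRestrictNormalHom L γ)) c)) =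
        γ • ν (Additive.ofMul c))
    (hνi : ∀ d : ClassGroup (𝓞 ↥(fixedField ((G₀ ⊓ Γ₀).map (absRestrictNormalHom L)))),
      ν (Additive.ofMul (classGroupExtend ↥(fixedField ((G₀ ⊓ Γ₀).map (absRestrictNormalHom L))) L d)) = 0) :
    ν = 0 := by
  have hp : p.Prime := Fact.out
  set S : Subgroup (L ≃ₐ[K] L) := (G₀ ⊓ Γ₀).map (absRestrictNormalHom L) with hSdef
  have hlift : ∀ s : S, ∃ g : absoluteGaloisGroup K, g ∈ G₀ ⊓ Γ₀ ∧ absRestrictNormalHom L g = s := fun s =>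
    Subgroup.mem_map.mp s.2
  choose lift hlift_mem hlift_res using hlift
  have hliftV : ∀ (s : S) (v : V), lift s • v = v := fun s v => hG₀ _ (Subgroup.mem_inf.mp (hlift_mem s)).1 v
  have hliftΓ : ∀ s : S, lift s ∈ Γ₀ := fun s => (Subgroup.mem_inf.mp (hlift_mem s)).2
  -- `ν(i(N c)) = ∑_{s ∈ S} lift s • ν c = #S • ν c`
  have hkey : ∀ c : ClassGroup (𝓞 L),
      ν (Additive.ofMul (classGroupExtend ↥(fixedField S) L (classGroupNorm ↥(fixedField S) L c))) =
        (Fintype.card S) • ν (Additive.ofMul c) := by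
    intro c
    rw [NormRelation.classGroupExtend_classGroupNorm_fixedField_eq_prod K L S c, ofMul_prod, map_sum]
    rw [show (∑ s : S, ν (Additive.ofMul (ClassGroup.mulEquiv (AmbiguousClass.intAut (s : L ≃ₐ[K] L)) c))) =
        ∑ _s : S, ν (Additive.ofMul c) from Finset.sum_congr rfl fun s _ => by
          rw [← hlift_res s, hν (lift s) (hliftΓ s) c, hliftV],
      Finset.sum_const, Finset.card_univ]
  have hSν : ∀ c : ClassGroup (𝓞 L), (Fintype.card S) • ν (Additive.ofMul c) = 0 := fun c => by
    rw [← hkey]; exact hνi _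
  have hcop : (Fintype.card S).Coprime p := by
    rw [← Nat.card_eq_fintype_card]
    exact Nat.coprime_comm.mp ((Nat.Prime.coprime_iff_not_dvd hp).mpr hH)
  refine AddMonoidHom.ext fun a => ?_
  have hord : addOrderOf (ν a) ∣ 1 := by
    rw [← hcop]
    refine Nat.dvd_gcd (addOrderOf_dvd_of_nsmul_eq_zero ?_) (addOrderOf_dvd_of_nsmul_eq_zero (hpV _))
    have h := hSν (Additive.toMul a)
    rwa [ofMul_toMul] at h
  rw [AddMonoidHom.zero_apply]
  exact AddMonoid.addOrderOf_eq_one_iff.mp (Nat.dvd_one.mp hord)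

/-- **Counting form**: in the setting of the previous theorem, `μ ↦ μ ∘ i_{L/L^S}` is injective on the `Γ₀`-equivariant additive maps
`Cl(𝓞_L) → V`, so their number is at most `#Hom(Cl(𝓞_{L^S}), V)`. [cite: DeoRaySujatha2023, §5 Lemma 5.1]
[cite: NeukirchANT1999, Ch. III §1 Prop. (1.6) (iv)] -/
theorem natCard_equivariantHom_le_natCard_hom_fixedField_of_trivial
    (L : IntermediateField K (AlgebraicClosure K)) [FiniteDimensional K L] [IsGalois K L]
    (Γ₀ G₀ : Subgroup (absoluteGaloisGroup K))
    {V : Type*} [AddCommGroup V] [Finite V] [DistribMulAction (absoluteGaloisGroup K) V]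
    {p : ℕ} [Fact p.Prime] (hpV : ∀ v : V, p • v = 0) (hG₀ : ∀ σ ∈ G₀, ∀ v : V, σ • v = v)
    (hH : ¬ p ∣ Nat.card ↥((G₀ ⊓ Γ₀).map (absRestrictNormalHom L))) :
    Nat.card {μ : Additive (ClassGroup (𝓞 L)) →+ V //
        ∀ γ ∈ Γ₀, ∀ c : ClassGroup (𝓞 L),
          μ (Additive.ofMul (ClassGroup.mulEquiv (AmbiguousClass.intAut (absRestrictNormalHom L γ)) c)) =
            γ • μ (Additive.ofMul c)} ≤
      Nat.card (Additive (ClassGroup (𝓞 ↥(fixedField ((G₀ ⊓ Γ₀).map (absRestrictNormalHom L))))) →+ V) := by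
  haveI : NumberField L := NumberField.of_module_finite K L
  set S : Subgroup (L ≃ₐ[K] L) := (G₀ ⊓ Γ₀).map (absRestrictNormalHom L) with hSdef
  haveI : Finite (Additive (ClassGroup (𝓞 ↥(fixedField S))) →+ V) :=
    Finite.of_injective (fun ν => (ν : Additive (ClassGroup (𝓞 ↥(fixedField S))) → V))
      (fun ν ν' h => DFunLike.coe_injective h)
  let Φ : {μ : Additive (ClassGroup (𝓞 L)) →+ V //
        ∀ γ ∈ Γ₀, ∀ c : ClassGroup (𝓞 L),
          μ (Additive.ofMul (ClassGroup.mulEquiv (AmbiguousClass.intAut (absRestrictNormalHom L γ)) c)) =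
            γ • μ (Additive.ofMul c)} →
      (Additive (ClassGroup (𝓞 ↥(fixedField S))) →+ V) :=
    fun μ => μ.1.comp (MonoidHom.toAdditive (classGroupExtend ↥(fixedField S) L))
  have hΦ : ∀ μ d, Φ μ (Additive.ofMul d) =
      μ.1 (Additive.ofMul (classGroupExtend ↥(fixedField S) L d)) := fun _ _ => rfl
  refine Nat.card_le_card_of_injective Φ fun μ μ' h => ?_
  apply Subtype.ext
  rw [← sub_eq_zero]
  refine equivariantHom_eq_zero_of_comp_classGroupExtend_eq_zero_of_trivial L Γ₀ G₀ hpV hG₀ hH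
    (μ.1 - μ'.1) (fun γ hγ c => ?_) (fun d => ?_)
  · rw [AddMonoidHom.sub_apply, AddMonoidHom.sub_apply, μ.2 γ hγ c, μ'.2 γ hγ c, smul_sub]
  · rw [AddMonoidHom.sub_apply, ← hΦ μ d, ← hΦ μ' d, h, sub_self]

/-- `[Cl : Cl^q]` is invariant under isomorphism of (class) groups. [folklore] -/
private theorem index_range_pow_eq_of_mulEquiv' {G H : Type*} [CommGroup G] [CommGroup H] (e : G ≃* H) (q : ℕ) :
    (powMonoidHom q : H →* H).range.index = (powMonoidHom q : G →* G).range.index := by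
  have hmap : (powMonoidHom q : G →* G).range.map e.toMonoidHom = (powMonoidHom q : H →* H).range := by
    ext h
    constructor
    · rintro ⟨x, ⟨y, rfl⟩, rfl⟩
      exact ⟨e y, by rw [powMonoidHom_apply, powMonoidHom_apply, MulEquiv.coe_toMonoidHom, map_pow]⟩
    · rintro ⟨y, rfl⟩
      refine ⟨e.symm y ^ q, ⟨e.symm y, rfl⟩, ?_⟩
      rw [powMonoidHom_apply, MulEquiv.coe_toMonoidHom, map_pow, MulEquiv.apply_symm_apply]
  rw [← hmap, Subgroup.index_map_of_bijective e.bijective]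

/-- **The equivariant class-group count at the layers, from bounded `p`-ranks of ONE subfield.**  `κ` a `ℤ_p`-extension of `K`,
`N ≤ G₀ ≤ Γ_K` with `N` open normal (`L = K̄^N` Galois, `#Gal(L/K)` prime to `p`), `G₀` open and acting trivially on the `p`-torsion
module `V`; `Ln = K̄^{N ∩ κ⁻¹(pⁿℤ_p)} = L·K_n`.  If some cyclotomic `ℤ_p`-extension `κ₀` of `K₀ = K̄^{G₀}` has `[Cl((K₀)_m) : Cl^p] ≤`
… precisely `rank_p Cl((K₀)_m) ≤ B` for all `m`, and `κ` is cyclotomic, then for every `n` the `Gal(K̄/K_n)`-equivariant additive maps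
`Cl(𝓞_{Ln}) → V` number at most `#V ^ (p ^ B)` (`K₀·K_n = K̄^{G₀ ∩ κ⁻¹(pⁿℤ_p)}` is a layer of the shifted base change of `κ` to `K₀`,
tree `ZpExtension.exists_zpExtension_shift`). [cite: DeoRaySujatha2023, §5 Lemma 5.1] [cite: Washington1997, §13.1]
[cite: NeukirchANT1999, Ch. IV §1 Thm. (1.2) (Krull)] -/
theorem natCard_equivariantHom_layer_le_of_classGroupPRank_le {p : ℕ} [Fact p.Prime] (κ : ZpExtension K p)
    (hκ : κ.IsCyclotomic) (N G₀ : Subgroup (absoluteGaloisGroup K)) [N.Normal] (hNG : N ≤ G₀)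
    (hN : IsOpen (N : Set (absoluteGaloisGroup K))) (hG₀open : IsOpen (G₀ : Set (absoluteGaloisGroup K)))
    (hNcard : ¬ p ∣ Nat.card ((fixedField N : IntermediateField K (AlgebraicClosure K)) ≃ₐ[K]
      (fixedField N : IntermediateField K (AlgebraicClosure K))))
    {V : Type*} [AddCommGroup V] [Finite V] [DistribMulAction (absoluteGaloisGroup K) V]
    (hpV : ∀ v : V, p • v = 0) (hG₀ : ∀ σ ∈ G₀, ∀ v : V, σ • v = v) (B : ℕ)
    (hB : ∃ κ₀ : ZpExtension ↥(fixedField G₀ : IntermediateField K (AlgebraicClosure K)) p,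
      κ₀.IsCyclotomic ∧ ∀ m, classGroupPRank κ₀ m ≤ B) (n : ℕ) :
    haveI : IsGalois K (fixedField (N ⊓ κ.layerSubgroup n) : IntermediateField K (AlgebraicClosure K)) :=
      isGalois_fixedField_inf_layerSubgroup κ N hN n
    Nat.card {μ : Additive (ClassGroup (𝓞 (fixedField (N ⊓ κ.layerSubgroup n) :
        IntermediateField K (AlgebraicClosure K)))) →+ V //
      ∀ γ ∈ κ.layerSubgroup n, ∀ c,
        μ (Additive.ofMul (ClassGroup.mulEquiv (AmbiguousClass.intAut
          (absRestrictNormalHom (fixedField (N ⊓ κ.layerSubgroup n) :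
            IntermediateField K (AlgebraicClosure K)) γ)) c)) = γ • μ (Additive.ofMul c)} ≤ Nat.card V ^ (p ^ B) := by
  have hpr : p.Prime := Fact.out
  haveI : NeZero p := ⟨hpr.ne_zero⟩
  set K₀ : IntermediateField K (AlgebraicClosure K) := fixedField G₀ with hK₀
  haveI : FiniteDimensional K K₀ := finiteDimensional_fixedField_of_isOpen G₀ hG₀open
  haveI : NumberField K₀ := NumberField.of_module_finite K K₀
  obtain ⟨κ₀, hκ₀, hBκ⟩ := hB
  -- the shifted base change `κ'` of `κ` to `K₀` is cyclotomic, so has the same `p`-ranks as `κ₀`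
  obtain ⟨a, κ', hs⟩ := exists_zpExtension_shift κ ↥K₀
  have hκ' : κ'.IsCyclotomic := isCyclotomic_of_shift κ ↥K₀ κ' hs hκ
  set Ln : IntermediateField K (AlgebraicClosure K) := fixedField (N ⊓ κ.layerSubgroup n) with hLn
  have hopen : IsOpen ((N ⊓ κ.layerSubgroup n : Subgroup (absoluteGaloisGroup K)) : Set (absoluteGaloisGroup K)) :=
    hN.inter (κ.isOpen_layerSubgroup n)
  haveI hgal : IsGalois K Ln := isGalois_fixedField_inf_layerSubgroup κ N hN n
  haveI : FiniteDimensional K Ln := finiteDimensional_fixedField_of_isOpen _ hopen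
  haveI : NumberField Ln := NumberField.of_module_finite K Ln
  haveI : Normal K (fixedField N : IntermediateField K (AlgebraicClosure K)) := isGalois_fixedField_of_isOpen N hN |>.to_normal
  have hL : ∀ σ : absoluteGaloisGroup K, absRestrictNormalHom Ln σ = 1 ↔ σ ∈ N ⊓ κ.layerSubgroup n := by
    intro σ
    rw [absRestrictNormalHom_eq_one_iff]
    exact SetLike.ext_iff.mp (fixingSubgroup_fixedField_of_isOpen _ hopen) σ
  have hL' : ∀ σ : absoluteGaloisGroup K,
      absRestrictNormalHom (fixedField N : IntermediateField K (AlgebraicClosure K)) σ = 1 ↔ σ ∈ N := by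
    intro σ
    rw [absRestrictNormalHom_eq_one_iff]
    exact SetLike.ext_iff.mp (fixingSubgroup_fixedField_of_isOpen _ hN) σ
  set S : Subgroup (Ln ≃ₐ[K] Ln) := (G₀ ⊓ κ.layerSubgroup n).map (absRestrictNormalHom Ln) with hS
  have hH : ¬ p ∣ Nat.card ↥S := fun h =>
    hNcard (h.trans (natCard_map_absRestrictNormalHom_dvd_card_aut Ln (fixedField N) (κ.layerSubgroup n)
      (G₀ ⊓ κ.layerSubgroup n) N inf_le_right hL hL'))
  have hVpos : 0 < Nat.card V := Nat.card_pos
  -- `F_n = Ln^S ≅ K̄^{G₀ ∩ κ⁻¹(pⁿℤ_p)} = K₀ ⊔ K_n ≅ κ'.layer m`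
  obtain ⟨m, hnm⟩ := exists_layerSubgroup_eq_comap_of_shift κ ↥K₀ κ' hs n
  obtain ⟨e⟩ := nonempty_ringEquiv_layer_fieldRange_sup_layer_of_layerSubgroup_eq κ ↥K₀ κ' hnm K₀.val
  have hfield : (K₀.val.fieldRange ⊔ κ.layer n) =
      (fixedField (G₀ ⊓ κ.layerSubgroup n) : IntermediateField K (AlgebraicClosure K)) := by
    rw [IntermediateField.fieldRange_val, hK₀,
      FineSelmerStabilizerDescent.fixedField_inf_layerSubgroup_eq_fixedField_sup_layer κ G₀ hG₀open n]
  have hlift : IntermediateField.lift (fixedField S : IntermediateField K Ln) =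
      (fixedField (G₀ ⊓ κ.layerSubgroup n) : IntermediateField K (AlgebraicClosure K)) :=
    FineSelmerStabilizerDescent.lift_fixedField_map_absRestrictNormalHom_eq Ln (G₀ ⊓ κ.layerSubgroup n)
      (N ⊓ κ.layerSubgroup n) (inf_le_inf_right _ hNG) hLn.symm
  let e' : ↥(κ'.layer m) ≃+* ↥(fixedField S : IntermediateField K Ln) :=
    e.trans ((IntermediateField.equivOfEq hfield).toRingEquiv.trans
      ((IntermediateField.liftAlgEquiv (fixedField S : IntermediateField K Ln)).trans
        (IntermediateField.equivOfEq hlift)).toRingEquiv.symm)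
  have hidx : (powMonoidHom p : ClassGroup (𝓞 ↥(fixedField S : IntermediateField K Ln)) →* _).range.index ≤ p ^ B := by
    rw [index_range_pow_eq_of_mulEquiv' (ClassGroup.mulEquiv (RingOfIntegers.mapRingEquiv e')) p,
      index_range_pow_layer_eq κ' m, classGroupPRank_eq_of_isCyclotomic κ' κ₀ hκ' hκ₀ m]
    exact Nat.pow_le_pow_right hpr.pos (hBκ m)
  calc Nat.card {μ : Additive (ClassGroup (𝓞 Ln)) →+ V //
          ∀ γ ∈ κ.layerSubgroup n, ∀ c,
            μ (Additive.ofMul (ClassGroup.mulEquiv (AmbiguousClass.intAut (absRestrictNormalHom Ln γ)) c)) =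
              γ • μ (Additive.ofMul c)}
        ≤ Nat.card (Additive (ClassGroup (𝓞 ↥(fixedField S))) →+ V) :=
      natCard_equivariantHom_le_natCard_hom_fixedField_of_trivial Ln (κ.layerSubgroup n) G₀ hpV hG₀ hH
    _ ≤ Nat.card V ^ (powMonoidHom p : ClassGroup (𝓞 ↥(fixedField S)) →* ClassGroup (𝓞 ↥(fixedField S))).range.index :=
      FineSelmerStabilizerDescent.natCard_addMonoidHom_le_pow_index hpV
    _ ≤ Nat.card V ^ (p ^ B) := Nat.pow_le_pow_right hVpos hidx

end Count

end Literature.NumberTheory.EllipticCurves.FineSelmerReducibleIsotypic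

/-! ## §3 Statement (A) on a reducible row from the `μ`-invariants of `K(χ₁)` and `K(χ₂)` -/

namespace Literature.NumberTheory.EllipticCurves.CoatesSujatha2005

open Literature.NumberTheory.IwasawaTheory Literature.NumberTheory.GaloisRepresentations
  Literature.NumberTheory.NumberFields Literature.NumberTheory.EllipticCurves
  Literature.NumberTheory.EllipticCurves.GreenbergSelmer Literature.NumberTheory.EllipticCurves.ZpExtension
  Literature.NumberTheory.IwasawaTheory.EquivariantUnramifiedHomsZpTowerFinite
  Literature.NumberTheory.EllipticCurves.FineSelmerReducibleIsotypic
  Literature.NumberTheory.EllipticCurves.FineSelmerDevissage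
-- `_root_`: some import closures declare `Literature.NumberTheory.EllipticCurves.WeierstrassCurve.*`
open _root_.WeierstrassCurve

variable {K : Type} [Field K] [NumberField K] (W : WeierstrassCurve K) [W.IsElliptic] {p : ℕ} [Fact p.Prime]

/-- **`Sel₀(K_∞, E[p])` is finite on a reducible row from BOUNDED `p`-RANKS along the cyclotomic towers of `K(χ₁)` and `K(χ₂)`.**
`E = W` elliptic over the number field `K`, `p` odd, `κ` the cyclotomic `ℤ_p`-extension, `C ≤ E[p]` a `Γ_K`-stable line
(`C ≠ ⊥, ⊤`), `K₁ = K̄^{ker χ₁}` (`ker χ₁ = fixingSubgroup Γ_K C`), `K₂ = K̄^{ker χ₂}` (`ker χ₂ =` the fixing subgroup of the cosets of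
`C`).  If some cyclotomic `ℤ_p`-extension of `K₁` has `rank_p Cl ≤ B₁` at every layer and some cyclotomic `ℤ_p`-extension of `K₂` has
`rank_p Cl ≤ B₂` at every layer, then `Sel₀(K_∞, E[p])` is finite.  (Equivariant dévissage + equivariant CFT count + the one-dimensional
descent of §2; `E[p]` unramified outside `p` and the bad places, AEC VII.4.1.)
[cite: CoatesSujatha2005, §3 Lemma 3.8, Thm. 3.4 and Cor. 3.6] [cite: Wuthrich2014, Lemma 14 (p. 396)] [cite: Lim2017FineSelmer, §3]
[cite: DeoRaySujatha2023, §5 Lemma 5.1] [cite: SilvermanAEC2009, Prop. VII.4.1 (a)] -/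
theorem fineSelmerInfty_torsion_finite_of_reducible_of_classGroupPRank_le (hp : p ≠ 2)
    (κ : ZpExtension K p) (hκ : κ.IsCyclotomic)
    (C : AddSubgroup (W.geomTorsion (p : ℤ)))
    (hC : ∀ (σ : absoluteGaloisGroup K) (x : W.geomTorsion (p : ℤ)), x ∈ C → σ • x ∈ C)
    (h1 : C ≠ ⊥) (h2 : C ≠ ⊤) (B₁ B₂ : ℕ)
    (hB₁ : ∃ κ₁ : ZpExtension ↥(fixedField (fixingSubgroup (absoluteGaloisGroup K) (C : Set (W.geomTorsion (p : ℤ)))) :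
        IntermediateField K (AlgebraicClosure K)) p, κ₁.IsCyclotomic ∧ ∀ m, classGroupPRank κ₁ m ≤ B₁)
    (hB₂ : ∃ κ₂ : ZpExtension ↥(fixedField (fixingSubgroup (absoluteGaloisGroup K)
        (Set.range fun y : W.geomTorsion (p : ℤ) => y +ᵥ (C : Set (W.geomTorsion (p : ℤ))))) :
        IntermediateField K (AlgebraicClosure K)) p, κ₂.IsCyclotomic ∧ ∀ m, classGroupPRank κ₂ m ≤ B₂) :
    (fineSelmerInfty (↥(W.geomTorsion (p : ℤ))) κ :
      Set (subgroupH1 κ.kerSubgroup (W.geomTorsion (p : ℤ)))).Finite := by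
  have hpr : p.Prime := Fact.out
  haveI : NeZero p := ⟨hpr.ne_zero⟩
  -- the module `M = E[p]`
  haveI hfinM : Finite (W.geomTorsion (p : ℤ)) := W.finite_geomTorsion_nat (NeZero.ne p)
  have hV : Nat.card (W.geomTorsion (p : ℤ)) = p ^ 2 := W.natCard_geomTorsion_eq_sq_of_charZero hpr
  have hcardC : Nat.card C = p := card_eq_of_ne_bot_of_ne_top hV h1 h2
  have hpM : ∀ m : ↥(W.geomTorsion (p : ℤ)), p • m = 0 := fun m =>
    Subtype.ext (by
      rw [AddSubmonoidClass.coe_nsmul, ZeroMemClass.coe_zero]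
      exact AddSubgroup.torsionBy.nsmul_iff.mp m.2)
  -- the Borel kernel `N` and the two character kernels `G₁ ⊇ N`, `G₂ ⊇ N`
  set N : Subgroup (absoluteGaloisGroup K) := W.borelKernel C with hNdef
  haveI hNn : N.Normal := borelKernel_normal hC
  have hNopen : IsOpen (N : Set (absoluteGaloisGroup K)) := isOpen_borelKernel C
  set G₁ : Subgroup (absoluteGaloisGroup K) :=
    fixingSubgroup (absoluteGaloisGroup K) (C : Set (W.geomTorsion (p : ℤ))) with hG₁
  set G₂ : Subgroup (absoluteGaloisGroup K) := fixingSubgroup (absoluteGaloisGroup K)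
    (Set.range fun y : W.geomTorsion (p : ℤ) => y +ᵥ (C : Set (W.geomTorsion (p : ℤ)))) with hG₂
  have hNG₁ : N ≤ G₁ := borelKernel_le_fixingSubgroup_coe
  have hNG₂ : N ≤ G₂ := borelKernel_le_fixingSubgroup_cosets hC
  have hG₁open : IsOpen (G₁ : Set (absoluteGaloisGroup K)) := Subgroup.isOpen_mono hNG₁ hNopen
  have hG₂open : IsOpen (G₂ : Set (absoluteGaloisGroup K)) := Subgroup.isOpen_mono hNG₂ hNopen
  -- `#Gal(K(χ₁,χ₂)/K) ∣ (p-1)²` is prime to `p`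
  haveI : FiniteDimensional K (W.borelField C) := finiteDimensional_borelField C
  haveI : IsGalois K (W.borelField C) := isGalois_borelField hC
  have hNcard : ¬ p ∣ Nat.card ((fixedField N : IntermediateField K (AlgebraicClosure K)) ≃ₐ[K]
      (fixedField N : IntermediateField K (AlgebraicClosure K))) := by
    change ¬ p ∣ Nat.card ((W.borelField C) ≃ₐ[K] (W.borelField C))
    rw [IsGalois.card_aut_eq_finrank]
    exact fun h => not_dvd_sub_one_sq hpr (h.trans (W.finrank_borelField_dvd hC h1 h2))
  -- the quotient module `Q = E[p]/C` with its `Γ_K`-action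
  set M : Type := ↥(W.geomTorsion (p : ℤ)) with hMdef
  letI instQ : DistribMulAction (absoluteGaloisGroup K) (M ⧸ C) :=
    { smul := fun σ ↦ QuotientAddGroup.map C C (DistribSMul.toAddMonoidHom M σ)
        (fun x hx ↦ AddSubgroup.mem_comap.2 (hC σ x hx))
      one_smul := fun q ↦ QuotientAddGroup.induction_on q fun m ↦ by
        change QuotientAddGroup.map C C (DistribSMul.toAddMonoidHom M 1) _ (m : M ⧸ C) = _
        rw [QuotientAddGroup.map_mk, DistribSMul.toAddMonoidHom_apply, one_smul]
      mul_smul := fun σ τ q ↦ QuotientAddGroup.induction_on q fun m ↦ by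
        change QuotientAddGroup.map C C (DistribSMul.toAddMonoidHom M (σ * τ)) _ (m : M ⧸ C) =
          QuotientAddGroup.map C C (DistribSMul.toAddMonoidHom M σ) _
            (QuotientAddGroup.map C C (DistribSMul.toAddMonoidHom M τ) _ (m : M ⧸ C))
        rw [QuotientAddGroup.map_mk, QuotientAddGroup.map_mk, QuotientAddGroup.map_mk,
          DistribSMul.toAddMonoidHom_apply, DistribSMul.toAddMonoidHom_apply,
          DistribSMul.toAddMonoidHom_apply, mul_smul]
      smul_zero := fun σ ↦ map_zero _
      smul_add := fun σ a b ↦ map_add _ a b }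
  letI : TopologicalSpace (M ⧸ C) := ⊥
  haveI : DiscreteTopology (M ⧸ C) := ⟨rfl⟩
  have hsmulQ : ∀ (σ : absoluteGaloisGroup K) (m : M), σ • (m : M ⧸ C) = ((σ • m : M) : M ⧸ C) :=
    fun σ m ↦ rfl
  let π : M →+ M ⧸ C := QuotientAddGroup.mk' C
  have hπ : ∀ (σ : absoluteGaloisGroup K) (m : M), π (σ • m) = σ • π m := fun σ m ↦ rfl
  have hπker : ∀ m : M, π m = 0 ↔ m ∈ C := fun m ↦ QuotientAddGroup.eq_zero_iff m
  have hNQ : ∀ σ ∈ N, ∀ q : M ⧸ C, σ • q = q := fun σ hσ q ↦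
    QuotientAddGroup.induction_on q fun m ↦ by
      rw [hsmulQ, QuotientAddGroup.eq_iff_sub_mem]
      exact (mem_borelKernel_iff.1 hσ).2 m
  have hNC : ∀ σ ∈ N, ∀ m : M, π m = 0 → σ • m = m := fun σ hσ m hm ↦
    (mem_borelKernel_iff.1 hσ).1 m ((hπker m).1 hm)
  have hG₂Q : ∀ σ ∈ G₂, ∀ q : M ⧸ C, σ • q = q := fun σ hσ q ↦
    QuotientAddGroup.induction_on q fun m ↦ by
      rw [hsmulQ, QuotientAddGroup.eq_iff_sub_mem]
      exact (mem_fixingSubgroup_cosets_iff hC σ).1 hσ m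
  have hpQ : ∀ q : M ⧸ C, p • q = 0 := fun q ↦
    QuotientAddGroup.induction_on q fun m ↦ by
      rw [← QuotientAddGroup.mk_nsmul, hpM, QuotientAddGroup.mk_zero]
  haveI : Finite (M ⧸ C) := inferInstance
  -- the submodule `C` with its `Γ_K`-action
  letI instC : DistribMulAction (absoluteGaloisGroup K) C :=
    { smul := fun σ c ↦ ⟨σ • (c : M), hC σ c c.2⟩
      one_smul := fun c ↦ Subtype.ext (one_smul _ (c : M))
      mul_smul := fun σ τ c ↦ Subtype.ext (mul_smul σ τ (c : M))
      smul_zero := fun σ ↦ Subtype.ext (smul_zero σ)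
      smul_add := fun σ a b ↦ Subtype.ext (smul_add σ (a : M) (b : M)) }
  haveI : DiscreteTopology C := inferInstance
  have hsmulC : ∀ (σ : absoluteGaloisGroup K) (c : C), ((σ • c : C) : M) = σ • (c : M) := fun σ c ↦ rfl
  have hNC' : ∀ σ ∈ N, ∀ c : C, σ • c = c := fun σ hσ c ↦
    Subtype.ext ((mem_borelKernel_iff.1 hσ).1 c c.2)
  have hG₁C : ∀ σ ∈ G₁, ∀ c : C, σ • c = c := fun σ hσ c ↦
    Subtype.ext ((mem_fixingSubgroup_coe_iff σ).1 hσ c c.2)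
  have hpC : ∀ c : C, p • c = 0 := fun c ↦ Subtype.ext (by
    rw [AddSubmonoidClass.coe_nsmul, ZeroMemClass.coe_zero]; exact hpM (c : M))
  haveI : Finite C := inferInstance
  -- the finite set `S` of places above `p` and bad places; `E[p]` unramified outside `S`
  have hSfin : ({v : HeightOneSpectrum (𝓞 K) | (p : 𝓞 K) ∈ v.asIdeal} ∪ W.badPlaces (𝓞 K)).Finite := by
    refine Set.Finite.union ?_ (W.finite_badPlaces_holds (𝓞 K))
    have hne : Ideal.span {(p : 𝓞 K)} ≠ 0 := by
      rw [Ideal.zero_eq_bot, Ne, Ideal.span_singleton_eq_bot]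
      exact_mod_cast hpr.ne_zero
    refine (Ideal.finite_factors hne).subset fun v hv ↦ ?_
    simp only [Set.mem_setOf_eq] at hv ⊢
    exact Ideal.dvd_iff_le.mpr ((Ideal.span_singleton_le_iff_mem _).mpr hv)
  have hunr : ∀ v ∉ ({v : HeightOneSpectrum (𝓞 K) | (p : 𝓞 K) ∈ v.asIdeal} ∪ W.badPlaces (𝓞 K)),
      ∀ 𝔓 ∈ v.primesAbove, ∀ σ ∈ 𝔓.inertia (absoluteGaloisGroup K), ∀ m : M, σ • m = m := by
    intro v hv 𝔓 h𝔓 σ hσ m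
    rw [Set.mem_union, not_or, Set.mem_setOf_eq, mem_badPlaces_iff, not_not] at hv
    exact W.smul_geomTorsion_eq_of_mem_inertia hv.2 (n := (p : ℤ)) (by exact_mod_cast hv.1) h𝔓 hσ m
  -- (Q) EQUIVARIANT everywhere-unramified homs with values in `E[p]/C` are finite: count through `K(χ₂)`
  have hQfin : {f ∈ unramifiedHoms (N ⊓ κ.kerSubgroup) (M ⧸ C) (∅ : Set (HeightOneSpectrum (𝓞 K))) |
      ∀ h ∈ κ.kerSubgroup, ∀ u u' : ↥(N ⊓ κ.kerSubgroup),
        (u' : absoluteGaloisGroup K) = h * u * h⁻¹ → f u' = h • f u}.Finite :=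
    equivariantUnramifiedHoms_finite_of_card_le κ N hNopen hp (M ⧸ C) hNQ hpQ (Nat.card (M ⧸ C) ^ (p ^ B₂))
      (natCard_equivariantHom_layer_le_of_classGroupPRank_le κ hκ N G₂ hNG₂ hNopen hG₂open hNcard hpQ hG₂Q B₂ hB₂)
  -- (C) EQUIVARIANT `C`-valued everywhere-unramified homs are finite: count through `K(χ₁)`
  have hCfin : {f ∈ unramifiedHoms (N ⊓ κ.kerSubgroup) M (∅ : Set (HeightOneSpectrum (𝓞 K))) |
      (∀ u, π (f u) = 0) ∧ ∀ h ∈ κ.kerSubgroup, ∀ u u' : ↥(N ⊓ κ.kerSubgroup),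
        (u' : absoluteGaloisGroup K) = h * u * h⁻¹ → f u' = h • f u}.Finite := by
    have h := equivariantUnramifiedHoms_finite_of_card_le κ N hNopen hp C hNC' hpC (Nat.card C ^ (p ^ B₁))
      (natCard_equivariantHom_layer_le_of_classGroupPRank_le κ hκ N G₁ hNG₁ hNopen hG₁open hNcard hpC hG₁C B₁ hB₁)
    -- every member is the image of an equivariant member of `Hom(U, C; ∅)`
    refine (h.image fun (f' : ↥(N ⊓ κ.kerSubgroup) → C) u ↦ (f' u : M)).subset ?_
    rintro f ⟨hf, hfπ, hfeq⟩
    have hfC : ∀ u, f u ∈ C := fun u ↦ (hπker _).1 (hfπ u)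
    refine ⟨fun u ↦ ⟨f u, hfC u⟩, ⟨⟨hf.1.subtype_mk _, fun σ τ ↦ Subtype.ext (hf.2.1 σ τ),
      fun v hv 𝔓 h𝔓 σ hσ ↦ Subtype.ext (hf.2.2 v hv 𝔓 h𝔓 σ hσ)⟩,
      fun h' hh' u u' hu' ↦ Subtype.ext (hfeq h' hh' u u' hu')⟩, rfl⟩
  -- equivariant dévissage
  exact finite_fineSelmerInfty_of_extension_equivariant κ hκ π hπ N hNopen hNQ hNC _ hSfin hunr hQfin hCfin

/-- **Statement (A) on a reducible row from BOUNDED `p`-RANKS of `K(χ₁)` and `K(χ₂)`** (the tree's `∃ γ D, Module.Finite ℤ_[p] D.X`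
spelling, by the Lim–Sujatha bricks). [cite: CoatesSujatha2005, §3 Thm. 3.4 and Cor. 3.6] [cite: LimSujatha2018, §3 (lemma before Prop. 3.2)]
[cite: Wuthrich2014, Lemma 14 (p. 396)] -/
theorem fineSelmerDual_moduleFinite_of_reducible_of_classGroupPRank_le (hp : p ≠ 2)
    (κ : ZpExtension K p) (hκ : κ.IsCyclotomic)
    (C : AddSubgroup (W.geomTorsion (p : ℤ)))
    (hC : ∀ (σ : absoluteGaloisGroup K) (x : W.geomTorsion (p : ℤ)), x ∈ C → σ • x ∈ C)
    (h1 : C ≠ ⊥) (h2 : C ≠ ⊤) (B₁ B₂ : ℕ)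
    (hB₁ : ∃ κ₁ : ZpExtension ↥(fixedField (fixingSubgroup (absoluteGaloisGroup K) (C : Set (W.geomTorsion (p : ℤ)))) :
        IntermediateField K (AlgebraicClosure K)) p, κ₁.IsCyclotomic ∧ ∀ m, classGroupPRank κ₁ m ≤ B₁)
    (hB₂ : ∃ κ₂ : ZpExtension ↥(fixedField (fixingSubgroup (absoluteGaloisGroup K)
        (Set.range fun y : W.geomTorsion (p : ℤ) => y +ᵥ (C : Set (W.geomTorsion (p : ℤ))))) :
        IntermediateField K (AlgebraicClosure K)) p, κ₂.IsCyclotomic ∧ ∀ m, classGroupPRank κ₂ m ≤ B₂) :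
    ∃ (γ : absoluteGaloisGroup K) (D : W.FineSelmerDualData κ γ),
      Module.Finite ℤ_[p] (RestrictScalars ℤ_[p] (IwasawaAlgebra p) D.X) := by
  rw [LimSujatha2018.fineSelmerDual_moduleFinite_iff_finite_fineSelmerInfty_torsion W hp κ hκ]
  exact fineSelmerInfty_torsion_finite_of_reducible_of_classGroupPRank_le W hp κ hκ C hC h1 h2 B₁ B₂ hB₁ hB₂

/-- **THE ISOTYPIC `μ`-ROAD ON A REDUCIBLE ROW (PROVED): `μ_p(K(χ₁)_cyc) = 0` and `μ_p(K(χ₂)_cyc) = 0 ⟹` statement (A) for `E` at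
`p`.**  `E = W` elliptic over a number field `K`, `p` odd, `C ≤ E[p]` a `Γ_K`-stable line, `K₁ = K(C) = K̄^{fixingSubgroup C}` (the
field generated by the points of `C`, `= K(P)` for a generator `P`: the kernel field of the `p`-isogeny `E → E/C`) and
`K₂ = K̄^{ker χ₂}` (the field cut out by the action on `E[p]/C`, `= K(P′)` for a generator `P′` of the kernel of the dual isogeny
`E/C → E`).  If every cyclotomic `ℤ_p`-extension of `K₁` and of `K₂` has vanishing classical `μ`-invariant (growth form), then for the
cyclotomic `ℤ_p`-extension `κ` of `K` the Pontryagin dual of `Sel₀(E/K_∞)[p^∞]` is finitely generated over `ℤ_p`.  Over `ℚ`: `ℚ(χ₁)`,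
`ℚ(χ₂)` are cyclic of degree dividing `p − 1`, one real and one imaginary; Ferrero–Washington for these two abelian fields is the
class-wide input, and per row Iwasawa 1956 / Fukuda / the one-layer small-rank criterion on these two fields are the doors.
[cite: CoatesSujatha2005, §3 Thm. 3.4, Lemma 3.8 and Cor. 3.6] [cite: Wuthrich2014, Lemma 14 (p. 396)] [cite: Lim2017FineSelmer, §3]
[cite: Washington1997, §13.3 Prop. 13.23 (μ = 0 ⟹ bounded p-ranks)] -/
theorem conjA_of_reducible_of_classicalMuVanishes_characterFields (hp : p ≠ 2)
    (C : AddSubgroup (W.geomTorsion (p : ℤ)))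
    (hC : ∀ (σ : absoluteGaloisGroup K) (x : W.geomTorsion (p : ℤ)), x ∈ C → σ • x ∈ C)
    (h1 : C ≠ ⊥) (h2 : C ≠ ⊤)
    (hμ₁ : ∀ κ₁ : ZpExtension ↥(fixedField (fixingSubgroup (absoluteGaloisGroup K) (C : Set (W.geomTorsion (p : ℤ)))) :
        IntermediateField K (AlgebraicClosure K)) p, κ₁.IsCyclotomic → ClassicalMuVanishes κ₁)
    (hμ₂ : ∀ κ₂ : ZpExtension ↥(fixedField (fixingSubgroup (absoluteGaloisGroup K)
        (Set.range fun y : W.geomTorsion (p : ℤ) => y +ᵥ (C : Set (W.geomTorsion (p : ℤ))))) :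
        IntermediateField K (AlgebraicClosure K)) p, κ₂.IsCyclotomic → ClassicalMuVanishes κ₂)
    (κ : ZpExtension K p) (hκ : κ.IsCyclotomic) :
    ∃ (γ : absoluteGaloisGroup K) (D : W.FineSelmerDualData κ γ),
      Module.Finite ℤ_[p] (RestrictScalars ℤ_[p] (IwasawaAlgebra p) D.X) := by
  have hpr : p.Prime := Fact.out
  haveI : NeZero p := ⟨hpr.ne_zero⟩
  haveI hfinM : Finite (W.geomTorsion (p : ℤ)) := W.finite_geomTorsion_nat (NeZero.ne p)
  set G₁ : Subgroup (absoluteGaloisGroup K) :=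
    fixingSubgroup (absoluteGaloisGroup K) (C : Set (W.geomTorsion (p : ℤ))) with hG₁
  set G₂ : Subgroup (absoluteGaloisGroup K) := fixingSubgroup (absoluteGaloisGroup K)
    (Set.range fun y : W.geomTorsion (p : ℤ) => y +ᵥ (C : Set (W.geomTorsion (p : ℤ)))) with hG₂
  have hNopen : IsOpen (W.borelKernel C : Set (absoluteGaloisGroup K)) := isOpen_borelKernel C
  have hG₁open : IsOpen (G₁ : Set (absoluteGaloisGroup K)) :=
    Subgroup.isOpen_mono borelKernel_le_fixingSubgroup_coe hNopen
  have hG₂open : IsOpen (G₂ : Set (absoluteGaloisGroup K)) :=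
    Subgroup.isOpen_mono (borelKernel_le_fixingSubgroup_cosets hC) hNopen
  set K₁ : IntermediateField K (AlgebraicClosure K) := fixedField G₁ with hK₁
  set K₂ : IntermediateField K (AlgebraicClosure K) := fixedField G₂ with hK₂
  haveI : FiniteDimensional K K₁ := finiteDimensional_fixedField_of_isOpen G₁ hG₁open
  haveI : NumberField K₁ := NumberField.of_module_finite K K₁
  haveI : FiniteDimensional K K₂ := finiteDimensional_fixedField_of_isOpen G₂ hG₂open
  haveI : NumberField K₂ := NumberField.of_module_finite K K₂
  -- cyclotomic `ℤ_p`-extensions of `K₁`, `K₂` exist (shifted base changes of `κ`); `μ = 0` bounds their `p`-ranks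
  obtain ⟨a₁, κ₁, hs₁⟩ := exists_zpExtension_shift κ ↥K₁
  have hκ₁ : κ₁.IsCyclotomic := isCyclotomic_of_shift κ ↥K₁ κ₁ hs₁ hκ
  obtain ⟨B₁, hB₁⟩ := exists_forall_classGroupPRank_le_of_classicalMuVanishes κ₁ (hμ₁ κ₁ hκ₁)
  obtain ⟨a₂, κ₂, hs₂⟩ := exists_zpExtension_shift κ ↥K₂
  have hκ₂ : κ₂.IsCyclotomic := isCyclotomic_of_shift κ ↥K₂ κ₂ hs₂ hκ
  obtain ⟨B₂, hB₂⟩ := exists_forall_classGroupPRank_le_of_classicalMuVanishes κ₂ (hμ₂ κ₂ hκ₂)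
  exact fineSelmerDual_moduleFinite_of_reducible_of_classGroupPRank_le W hp κ hκ C hC h1 h2 B₁ B₂
    ⟨κ₁, hκ₁, hB₁⟩ ⟨κ₂, hκ₂, hB₂⟩

/-- **(A) at `(E, p)` for `E[p]` REDUCIBLE from the `μ`-invariants of the character fields of ANY stable line** (existence form: some
`Γ_K`-stable `C ≠ ⊥, ⊤` exists when `E[p]` is reducible, tree `HasIrreducibleModPGaloisRep`).
[cite: CoatesSujatha2005, §3 Cor. 3.6] [cite: Wuthrich2014, Lemma 14 (p. 396)] -/
theorem conjA_of_not_irreducible_of_forall_line_classicalMuVanishes (hp : p ≠ 2)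
    (hred : ¬ W.HasIrreducibleModPGaloisRep p)
    (hμ : ∀ C : AddSubgroup (W.geomTorsion (p : ℤ)),
      (∀ (σ : absoluteGaloisGroup K) (x : W.geomTorsion (p : ℤ)), x ∈ C → σ • x ∈ C) → C ≠ ⊥ → C ≠ ⊤ →
      (∀ κ₁ : ZpExtension ↥(fixedField (fixingSubgroup (absoluteGaloisGroup K) (C : Set (W.geomTorsion (p : ℤ)))) :
          IntermediateField K (AlgebraicClosure K)) p, κ₁.IsCyclotomic → ClassicalMuVanishes κ₁) ∧
      (∀ κ₂ : ZpExtension ↥(fixedField (fixingSubgroup (absoluteGaloisGroup K)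
          (Set.range fun y : W.geomTorsion (p : ℤ) => y +ᵥ (C : Set (W.geomTorsion (p : ℤ))))) :
          IntermediateField K (AlgebraicClosure K)) p, κ₂.IsCyclotomic → ClassicalMuVanishes κ₂))
    (κ : ZpExtension K p) (hκ : κ.IsCyclotomic) :
    ∃ (γ : absoluteGaloisGroup K) (D : W.FineSelmerDualData κ γ),
      Module.Finite ℤ_[p] (RestrictScalars ℤ_[p] (IwasawaAlgebra p) D.X) := by
  obtain ⟨C, hC, h1, h2⟩ : ∃ C : AddSubgroup (W.geomTorsion (p : ℤ)),
      (∀ (σ : absoluteGaloisGroup K) (x : W.geomTorsion (p : ℤ)), x ∈ C → σ • x ∈ C) ∧ C ≠ ⊥ ∧ C ≠ ⊤ := by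
    unfold HasIrreducibleModPGaloisRep at hred
    push Not at hred
    obtain ⟨C, hC, h1, h2⟩ := hred
    exact ⟨C, hC, h1, h2⟩
  obtain ⟨hμ₁, hμ₂⟩ := hμ C hC h1 h2
  exact conjA_of_reducible_of_classicalMuVanishes_characterFields W hp C hC h1 h2 hμ₁ hμ₂ κ hκ

end Literature.NumberTheory.EllipticCurves.CoatesSujatha2005

end
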